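/-
Copyright: the b2b-balaban cell (near-miss cell 7), T⁴-continuum fan-out, lineage t4-ne7b-p3 (node U5c LARGE-DEVIATION
member P3).  Released under the licence of the surrounding project.
-/
import Summits.QuantumFields.BalabanUV.T4Continuum.Support.SpaceTimeBankedRateLE
import Summits.QuantumFields.BalabanUV.T4Continuum.Support.SpaceTimeAssembly

/-!
# Space-time Peierls ∕ Cramér route for NE7b — THE ASSEMBLY ON THE LE ROAD: lineage readings with `ConsistentTLE id`
# (renewal no later than the booked reach), the pinned-contour bound from the pay inequalities, and the flow END with
# ONE infrared threshold (`exists_payThreshold`) — NO `RenewAtReach`, NO `Banking` structure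

Summits-side support leaf of the T⁴-continuum cell (rung (B)+1 on a FINITE torus only; NOT infinite volume, NOT the
mass gap, NOT the Clay statement; NOT a proof of the spine estimate NE7b).  Lineage `t4-ne7b-p3` (generation 3), node
U5c, skeleton `t4/skeletons/NE7b-t4-ne7b-p3.md` §13 (the LE road).  [folklore] assembly over this lineage's
`SpaceTimeAssembly` (`LineageReadings`, the (B)-denominator plumbing), `SpaceTimeOccBridge`
(`exists_relWeightBound_of_occLeaves`), `SpaceTimePinningK` (`factor_of_surplusK`, `pinnedContourBound_of_splitK`),
`SpaceTimeThreshold` (`withBanks`, `survivalRate`, `rateB_withBanks`, `lt_survivalRate`, `survives_of_lt`),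
`SpaceTimeBankedRateLE` (`surplus_ge_rateB_LE`, `volumeAccounting_of_consistentTLE`), the COUNT swarm's
`HistoryBankingLE.ConsistentTLE` and `Lit.T4TaggedShapeBanking.{exists_payThreshold, consistentT_id_iff}`,
`Lit.T4PrintedShapeBanking.one_le_R` — all BY NAME; nothing printed is asserted; no `[cite:]` tag.

WHAT.
* §1 **`LineageReadingsLE`** = `LineageReadings` with the admissibility of the pinned lineage's genealogy weakened from
  `Consistent` (renewal AT the booked reach) to `ConsistentTLE id` (renewal NO LATER than it) — the clause the geometry
  of a realised history supplies (`HistoryRealise.consistentTLE_toGen_of_realises`); `LineageReadings.toLE` (the old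
  readings are a special case, `consistentT_id_iff` + `ConsistentTLE.of_consistentT`); **`PayIneqs C L K R g`** — the
  COUNT member's three scale-indexed pay inequalities at the cutoff (named hypothesis shape; `exists_payThreshold` puts
  them past one infrared value of `log g_K⁻²` along the typed flow); **`pinnedContourBound_of_readingsLE`**: leaf A3
  from `LineageReadingsLE`, valid constants, (2.9), `L ≥ 1`, sizes `R ≥ 1`, `PayIneqs`, cell constants.
* §2 **`RunReadingsFlowLE`** (one run, one `(K, t)`: the typed flow facts (2.7) ∕ (2.9) ∕ (2.5) ∕ `1 ≤ log g⁻²` ∕ the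
  infrared value, and `LineageReadingsLE`), `occLeaves_of_readingsLE`, and THE END
  **`exists_irThresholdLE_relWeightBound`**: for valid base constants (`a, A₀ > 0`, `L ≥ 1`, `β₀ ≥ 0`,
  `r(q′+1) < p₀`), `Δ₁ > 0`, `cA, cB > 0`, `dC ≥ 0`, `c₃`, with banks at the survival rate there is ONE `x₀` (constants
  only) such that two-run families with `RunReadingsFlowLE` at every `(K, t)` from `K₀`, `LowEnvelope` ×2, `j⋆ ≤ K`,
  `Nanc ≥ 0` and I-1 give `∃ K₁ ≥ K₀, RelWeightBound …` with `W = 𝟙·Cst·contourBudget Nanc (Δ₁e^{−(survivalRate − c₃)}) j⋆`.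
WHAT THIS MOVES.  The finding F-1(c) (`RenewAtReach`) leaves the CONTOUR route: its factor half now runs on the COUNT
swarm's LE banked induction.  Displayed as before: the readings, BetaPertH behind the flow facts, (B) in `LowEnvelope`.

HONEST DEPENDENCY (cell, verbatim): continuum YM on T⁴ ⇐ BetaPertH ∧ nine spine estimates (0/9 proved); BetaPertH ⇐
(D1) ∧ (D4) ∧ CAP+tail; G-an2-4 gates asym, D1 and NE2/3/4.  This file changes none of it.
-/

open Finset

namespace Summit.QuantumFields.BalabanUV.T4Continuum.SpaceTimePeierls

open Literature.MathematicalPhysics.QuantumFieldTheory.Balaban1983to89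
open T4WeightBudget T4StabilitySocket T4PersistenceDictionary T4BankedInduction T4PrintedShapeBanking
open T4TaggedShapeBanking (exists_payThreshold consistentT_id_iff)
open Summit.QuantumFields.BalabanUV.T4Continuum.HistoryBankingLE (ConsistentTLE)
open SpaceTimePeierlsLeaves

noncomputable section

/-! ## §1 The lineage readings on the LE road and the pinned-contour bound -/

section OneRun

variable {ι : Type*} {Cell : Type} [Fintype Cell]

open Classical in
/-- **THE LINEAGE READINGS ON THE LE ROAD** of ONE run at one `(K, t)` over an occupancy model `M`: as
`SpaceTimeAssembly.LineageReadings` (entropy fields, nonnegativity, cover, and the lineage data of every pinned contour —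
genealogy, cut, cell binder, factorisation, remainder), with the genealogy's admissibility `ConsistentTLE id C Kc R`
(renewal no later than the booked reach) in place of `Consistent`. A hypothesis shape; nothing asserted. [folklore] -/
structure LineageReadingsLE (M : OccModel ι Cell) [DecidableRel M.Adj.Adj] (C : T4PrintedShapeBanking.Consts)
    (K Kc : ℕ) (R : ℕ → ℕ) (g : ℕ → ℝ) (A : ι → ℝ) (Bad : Finset ι) (jlo : ℕ) (nup : ℝ) (Δ : ℕ)
    (Δ₁ Nanc cA cB dC c₃ : ℝ) : Prop where
  /-- entropy: degree bound of the space-time adjacency -/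
  deg : ∀ c, M.Adj.degree c ≤ Δ
  /-- entropy: site animals (leaf A1) -/
  animal : SiteAnimalBound Δ Δ₁
  /-- entropy: the anchors (cells of the final scale `K`) -/
  anchors : (((univ : Finset Cell).filter fun c => M.scale c = K).card : ℝ) ≤ Nanc
  /-- I-2: nonnegative weights -/
  nonneg : ∀ τ ∈ M.T, 0 ≤ A τ
  /-- A2c: every bad term has a contour meeting every scale of `[jlo, K]` -/
  cover : M.ContourCover Bad jlo K
  /-- A2b ∕ (ID) ∕ A3a ∕ A3e ∕ A3f: the lineage data of every pinned contour, LE-consistent -/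
  lineage : ∃ (gen : ι → Finset Cell → Gen PEv) (rest : Finset Cell → ι → ℝ) (tcut : ι → Finset Cell → ℕ),
    (∀ (𝒦 : Finset Cell), ∀ τ ∈ M.T, M.IsContour τ 𝒦 →
        ConsistentTLE id C Kc R (gen τ 𝒦) ∧ (gen τ 𝒦).WF (dictW R C.n₁) ∧
        tcut τ 𝒦 ≤ (gen τ 𝒦).reach (dictW R C.n₁) ∧
        (𝒦.card : ℝ) ≤ cA * treeD PEv.fat PEv.step dC (gen τ 𝒦) (tcut τ 𝒦) +
          cB * treeSteps PEv.step (gen τ 𝒦) (tcut τ 𝒦) ∧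
        A τ ≤ Real.exp (-(credits (credit C g) (gen τ 𝒦) - lifeCost (dictW R C.n₁) (cost C Kc R) (gen τ 𝒦))) *
          rest 𝒦 τ) ∧
    (∀ (𝒦 : Finset Cell), ∀ τ ∈ M.T, 0 ≤ rest 𝒦 τ) ∧
    (∀ (𝒦 : Finset Cell), ∑ τ ∈ M.T.filter (fun τ => M.IsContour τ 𝒦), rest 𝒦 τ ≤ Real.exp c₃ ^ 𝒦.card * nup)

variable {M : OccModel ι Cell} [DecidableRel M.Adj.Adj] {C : T4PrintedShapeBanking.Consts} {K Kc : ℕ} {R : ℕ → ℕ}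
  {g : ℕ → ℝ} {A : ι → ℝ} {Bad : Finset ι} {jlo : ℕ} {nup : ℝ} {Δ : ℕ} {Δ₁ Nanc cA cB dC c₃ : ℝ}

/-- the old readings (renewal AT the reach) are a special case of the LE readings [folklore] -/
theorem LineageReadings.toLE (h : LineageReadings M C K Kc R g A Bad jlo nup Δ Δ₁ Nanc cA cB dC c₃) :
    LineageReadingsLE M C K Kc R g A Bad jlo nup Δ Δ₁ Nanc cA cB dC c₃ := by
  obtain ⟨gen, rest, tcut, hlin, hrest, hrem⟩ := h.lineage
  refine ⟨h.deg, h.animal, h.anchors, h.nonneg, h.cover, gen, rest, tcut, fun 𝒦 τ hτ hc => ?_, hrest, hrem⟩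
  obtain ⟨hcons, hwf, hcut, hcells, hfac⟩ := hlin 𝒦 τ hτ hc
  exact ⟨ConsistentTLE.of_consistentT ((consistentT_id_iff (C := C) (K := Kc) (R := R) _).2 hcons), hwf, hcut,
    hcells, hfac⟩

/-- **THE PAY INEQUALITIES** of the COUNT member at the cutoff `K` along the run `(R, g)` with block size `L`: birth
(the quadratic credit pays the birth's window floor, size epoch, banks and reserve), renewal (`p₀(g_h)` pays the renewed
line's window and bank), merger (`2p₀` of the absorbed root pays the extension and bank).  A named hypothesis shape —
`Lit.T4TaggedShapeBanking.exists_payThreshold` inhabits it past one infrared value of `log g_K⁻²` along the typed flow;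
nothing asserted. [folklore] -/
def PayIneqs (C : T4PrintedShapeBanking.Consts) (L K : ℕ) (R : ℕ → ℕ) (g : ℕ → ℝ) : Prop :=
  (∀ s, s ≤ K → ∀ d' : ℕ,
      (C.Eb + C.μ + (3 * C.E₂ * (L : ℝ) ^ C.q' + C.E₃ * (L : ℝ) ^ C.q' + 3 * C.κ₁) * (R s : ℝ) ^ (C.q' + 1)) *
          ((d' : ℝ) + 1) + 2 * p0Profile C.A₀ C.p₀ (g s) ≤
        C.a * (p0Profile C.A₀ C.p₀ (g s)) ^ 2 * ((d' : ℝ) + 1) + 2 * p0Profile C.A₀ C.p₀ (g s)) ∧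
  (∀ h, h + 1 ≤ K →
      2 * C.E₂ * (L : ℝ) ^ C.q' * (R (h + 1) : ℝ) ^ (C.q' + 1) + (C.κ₁ * ((R (h + 1) : ℝ) + 1) + C.E₀) ≤
        p0Profile C.A₀ C.p₀ (g h)) ∧
  (∀ m s, m ≤ s → s ≤ K →
      ((1 + C.n₁) * C.E₂ * (L : ℝ) ^ C.q' + C.dC * C.E₃ * (L : ℝ) ^ C.q') * (R s : ℝ) ^ (C.q' + 1) +
          (C.κ₁ * ((C.n₁ : ℝ) + R s) + C.E₀) ≤ 2 * p0Profile C.A₀ C.p₀ (g m))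

/-- **LEAF A3 ON THE LE ROAD.**  The LE lineage readings of a run, valid constants with `0 ≤ A₀`, a nonnegative profile
on performed steps, (2.9) along the run, `L ≥ 1`, sizes `R ≥ 1`, the pay inequalities at the cutoff and positive cell
constants give the PINNED-CONTOUR BOUND with price `e^{−(rateB − c₃)}` — by `surplus_ge_rateB_LE` (the COUNT swarm's
`bankedLE_induction`) in place of `surplus_ge_rateB_printedShape`. [folklore] -/
theorem pinnedContourBound_of_readingsLE {L : ℕ} {β' β₀ : ℝ}
    (h : LineageReadingsLE M C K Kc R g A Bad jlo nup Δ Δ₁ Nanc cA cB dC c₃) (hC : C.Valid) (hA0 : 0 ≤ C.A₀)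
    (hx0 : ∀ s, s ≤ Kc → 0 ≤ Real.log ((g s) ^ 2)⁻¹) (h29 : B14FlowStep.FlowIneq29 R g L β' β₀ Kc) (hL : 1 ≤ L)
    (hR1 : ∀ s, s ≤ Kc → 1 ≤ R s) (hpay : PayIneqs C L Kc R g) (hcA : 0 < cA) (hcB : 0 < cB) (hdC : 0 ≤ dC) :
    M.PinnedContourBound A (Real.exp (-(rateB C.κ₁ C.Eb C.μ (2 * cA) (cB + 2 * cA * dC) - c₃))) nup := by
  classical
  obtain ⟨gen, rest, tcut, hlin, hrest, hrem⟩ := h.lineage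
  obtain ⟨Hb, Hr, Hm⟩ := hpay
  have hC₁ : 0 < 2 * cA := by positivity
  have hC₂ : 0 < cB + 2 * cA * dC := by positivity
  -- the factor half from the banked rate of the pinned lineage, LE road
  have hfac := factor_of_surplusK (M := M) (A := A) (rest := rest)
    (S := fun 𝒦 τ => credits (credit C g) (gen τ 𝒦) - lifeCost (dictW R C.n₁) (cost C Kc R) (gen τ 𝒦))
    (s := rateB C.κ₁ C.Eb C.μ (2 * cA) (cB + 2 * cA * dC)) hrest
    (fun 𝒦 τ hτ hc => (hlin 𝒦 τ hτ hc).2.2.2.2)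
    (fun 𝒦 τ hτ hc => by
      obtain ⟨hcons, hwf, hcut, hcells, -⟩ := hlin 𝒦 τ hτ hc
      exact surplus_ge_rateB_LE hC h29 hL hR1 Hb Hr Hm hA0 hx0 hC₁ hC₂ hcons hwf
        (volumeAccounting_of_consistentTLE (cost := cost C Kc R) (credit := credit C g) hcA.le hcB.le hdC hcons
          hwf hcut hcells))
  have hsplit : M.PinnedSplitK A rest (Real.exp (-rateB C.κ₁ C.Eb C.μ (2 * cA) (cB + 2 * cA * dC)))
      (Real.exp c₃) nup :=
    ⟨hrest, hfac, hrem⟩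
  have key := OccModel.pinnedContourBound_of_splitK hsplit (Real.exp_nonneg _)
  have hq : Real.exp (-rateB C.κ₁ C.Eb C.μ (2 * cA) (cB + 2 * cA * dC)) * Real.exp c₃ =
      Real.exp (-(rateB C.κ₁ C.Eb C.μ (2 * cA) (cB + 2 * cA * dC) - c₃)) := by
    rw [← Real.exp_add]
    congr 1
    ring
  rw [hq] at key
  exact key

end OneRun

/-! ## §2 The flow END on the LE road: one infrared threshold, survival automatic -/

section Flow

variable {ι : Type*} [DecidableEq ι]

/-- NAMED SHAPE `RunReadingsFlowLE C L r β₀ x₀ T X Bad xup jstar Δ₁ Nanc cA cB dC c₃ K t` (ONE run, ONE `(K, t)`): on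
SOME finite occupancy model of the run's terms `T K`, for SOME genealogy cutoff `Kc` and flow run `(R, g, β′)` with
THE TYPED FLOW FACTS — (2.7) `B14.FlowIneq27`, (2.9) `B14FlowStep.FlowIneq29`, (2.5) `B14.IsRj` along the run,
`1 ≤ log g_s⁻²`, the infrared value `x₀ ≤ log g_{Kc}⁻²` (BetaPertH behind them) — the LE lineage readings hold.
A hypothesis shape; nothing asserted. [folklore] -/
def RunReadingsFlowLE (C : T4PrintedShapeBanking.Consts) (L r : ℕ) (β₀ x₀ : ℝ) (T : ℕ → Finset ι)
    (X : ℕ → ℝ → ι → ℝ) (Bad : ℕ → ℝ → Finset ι) (xup : ℕ → ℝ → ℝ) (jstar : ℕ → ℕ) (Δ₁ Nanc cA cB dC c₃ : ℝ)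
    (K : ℕ) (t : ℝ) : Prop :=
  ∃ (Cell : Type) (_ : Fintype Cell) (_ : DecidableEq Cell) (M : OccModel ι Cell) (_ : DecidableRel M.Adj.Adj)
    (Δ Kc : ℕ) (R : ℕ → ℕ) (g : ℕ → ℝ) (β' : ℝ),
    M.T = T K ∧ B14.FlowIneq27 g β' β₀ C.p₀ Kc ∧ B14FlowStep.FlowIneq29 R g L β' β₀ Kc ∧
    (∀ s, s ≤ Kc → B14.IsRj L r (g s) (R s)) ∧ (∀ s, s ≤ Kc → 1 ≤ Real.log ((g s) ^ 2)⁻¹) ∧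
    x₀ ≤ Real.log ((g Kc) ^ 2)⁻¹ ∧
    LineageReadingsLE M C K Kc R g (X K t) (Bad K t) (jstar K) (xup K t) Δ Δ₁ Nanc cA cB dC c₃

omit [DecidableEq ι] in
/-- the old flow readings are a special case [folklore] -/
theorem RunReadingsFlow.toLE {C : T4PrintedShapeBanking.Consts} {L r : ℕ} {β₀ x₀ : ℝ} {T : ℕ → Finset ι}
    {X : ℕ → ℝ → ι → ℝ} {Bad : ℕ → ℝ → Finset ι} {xup : ℕ → ℝ → ℝ} {jstar : ℕ → ℕ} {Δ₁ Nanc cA cB dC c₃ : ℝ}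
    {K : ℕ} {t : ℝ} (h : RunReadingsFlow C L r β₀ x₀ T X Bad xup jstar Δ₁ Nanc cA cB dC c₃ K t) :
    RunReadingsFlowLE C L r β₀ x₀ T X Bad xup jstar Δ₁ Nanc cA cB dC c₃ K t := by
  obtain ⟨Cell, hF, hD, M, hR, Δ, Kc, R, g, β', hT, h27, h29, hRj, hx1, hxK, hL⟩ := h
  exact ⟨Cell, hF, hD, M, hR, Δ, Kc, R, g, β', hT, h27, h29, hRj, hx1, hxK, hL.toLE⟩

omit [DecidableEq ι] in
/-- **THE LE READINGS OF A RUN WITH ITS PAY INEQUALITIES GIVE ITS `OccLeaves`** (A1 ∧ A2c ∧ A3 ∧ I-2) with the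
survival exponent `s₁ = rateB − c₃`. [folklore] -/
theorem occLeaves_of_readingsLE {C : T4PrintedShapeBanking.Consts} (hC : C.Valid) (hA0 : 0 ≤ C.A₀) {L : ℕ}
    (hL : 1 ≤ L) {Δ₁ Nanc cA cB dC c₃ : ℝ} (hcA : 0 < cA) (hcB : 0 < cB) (hdC : 0 ≤ dC) {T : ℕ → Finset ι}
    {X : ℕ → ℝ → ι → ℝ} {Bad : ℕ → ℝ → Finset ι} {xup : ℕ → ℝ → ℝ} {jstar : ℕ → ℕ} {K : ℕ} {t : ℝ}
    {Cell : Type} [Fintype Cell] [DecidableEq Cell] {M : OccModel ι Cell} [DecidableRel M.Adj.Adj] {Δ Kc : ℕ}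
    {R : ℕ → ℕ} {g : ℕ → ℝ} {β' β₀ : ℝ} {r : ℕ} (hT : M.T = T K) (h29 : B14FlowStep.FlowIneq29 R g L β' β₀ Kc)
    (hRj : ∀ s, s ≤ Kc → B14.IsRj L r (g s) (R s)) (hx1 : ∀ s, s ≤ Kc → 1 ≤ Real.log ((g s) ^ 2)⁻¹)
    (hpay : PayIneqs C L Kc R g)
    (hLE : LineageReadingsLE M C K Kc R g (X K t) (Bad K t) (jstar K) (xup K t) Δ Δ₁ Nanc cA cB dC c₃) :
    OccLeaves T X Bad xup jstar Nanc Δ₁ (rateB C.κ₁ C.Eb C.μ (2 * cA) (cB + 2 * cA * dC) - c₃) K t := by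
  refine ⟨Cell, inferInstance, inferInstance, M, inferInstance, Δ, hT, hLE.deg, hLE.animal, hLE.anchors, hLE.cover,
    ?_, ?_⟩
  · exact pinnedContourBound_of_readingsLE hLE hC hA0 (fun s hs => by linarith [hx1 s hs]) h29 hL
      (one_le_R hRj hL) hpay hcA hcB hdC
  · intro τ hτ
    exact hLE.nonneg τ (hT ▸ hτ)

/-- **THE END OF THE CONTOUR ROUTE ON THE LE ROAD — ONE INFRARED THRESHOLD, SURVIVAL AUTOMATIC, NO RENEWAL-AT-REACH
CLAUSE.**  For valid base constants `C₀` (`a, A₀ > 0`), block size `L ≥ 1`, `β₀ ≥ 0`, the exponent condition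
`r(q′+1) < p₀`, a site-animal constant `Δ₁ > 0`, a multiplicity `c₃` and cell constants `cA, cB > 0`, `dC ≥ 0`, put
the banks at the survival rate: `C := withBanks C₀ (survivalRate Δ₁ c₃) (2cA) (cB + 2cA·dC)`.  THEN THERE IS ONE
NUMBER `x₀` — depending on these constants only — such that for every two-run family whose runs carry the LE lineage
readings for `C` together with the typed flow facts and the infrared value `log g_{Kc}⁻² ≥ x₀` at every `(K, t)` from
`K₀` on (`RunReadingsFlowLE`), the denominators `LowEnvelope` with a common constant, `j⋆(K) ≤ K`, `Nanc ≥ 0` and the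
matching-scale fraction `c·K ≤ K − j⋆(K)`, NE7b's output shape `RelWeightBound` holds with the bad classes emptied
below some `K₁ ≥ K₀` and `W = 𝟙_{K ≥ K₁}·Cst·Nanc·ϱ^{K−j⋆(K)+1}/(1−ϱ)`, `ϱ = Δ₁·e^{−(survivalRate − c₃)} < 1`.
The threshold is `Lit.T4TaggedShapeBanking.exists_payThreshold` (the pay inequalities past `x₀`); the factor half is
the COUNT swarm's LE banked induction.  NOT a proof of NE7b: the readings, BetaPertH behind the flow facts, and (B)
inside `LowEnvelope` stay displayed. [folklore] -/
theorem exists_irThresholdLE_relWeightBound (C₀ : T4PrintedShapeBanking.Consts) (hC₀ : C₀.Valid) (ha : 0 < C₀.a)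
    (hA : 0 < C₀.A₀) {L r : ℕ} (hL : 1 ≤ L) {β₀ : ℝ} (hβ : 0 ≤ β₀) (hrq : r * (C₀.q' + 1) < C₀.p₀)
    {Δ₁ cA cB dC : ℝ} (hΔ₁ : 0 < Δ₁) (hcA : 0 < cA) (hcB : 0 < cB) (hdC : 0 ≤ dC) (c₃ : ℝ) :
    ∃ x₀ : ℝ, ∀ (l₀ : ℝ) (T : ℕ → Finset ι) (A B : ℕ → ℝ → ι → ℝ) (Bad : ℕ → ℝ → Finset ι)
      (nup mup nlow mlow : ℕ → ℝ → ℝ) (Cst : ℝ) (K₀ : ℕ) (jstar : ℕ → ℕ) (Nanc c : ℝ),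
      (∀ K t, |t| ≤ l₀ → K₀ ≤ K → RunReadingsFlowLE (withBanks C₀ (survivalRate Δ₁ c₃) (2 * cA) (cB + 2 * cA * dC))
        L r β₀ x₀ T A Bad nup jstar Δ₁ Nanc cA cB dC c₃ K t) →
      (∀ K t, |t| ≤ l₀ → K₀ ≤ K → RunReadingsFlowLE (withBanks C₀ (survivalRate Δ₁ c₃) (2 * cA) (cB + 2 * cA * dC))
        L r β₀ x₀ T B Bad mup jstar Δ₁ Nanc cA cB dC c₃ K t) →
      LowEnvelope l₀ T A nlow nup Cst K₀ → LowEnvelope l₀ T B mlow mup Cst K₀ → 0 ≤ Cst →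
      (∀ K, jstar K ≤ K) → 0 ≤ Nanc → 0 < c → (∀ K : ℕ, c * K ≤ ((K - jstar K : ℕ) : ℝ)) →
      ∃ K₁, K₀ ≤ K₁ ∧ RelWeightBound l₀ T A B (fun K t => if K₁ ≤ K then Bad K t else ∅)
        (Set.indicator {K | K₁ ≤ K} (fun K => Cst *
          contourBudget Nanc (Δ₁ * Real.exp (-(survivalRate Δ₁ c₃ - c₃))) jstar K)) := by
  have hC₁ : 0 < 2 * cA := by positivity
  have hC₂ : 0 < cB + 2 * cA * dC := by positivity
  set C := withBanks C₀ (survivalRate Δ₁ c₃) (2 * cA) (cB + 2 * cA * dC) with hC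
  have hV : C.Valid := withBanks_valid hC₀ (survivalRate_nonneg Δ₁ c₃) hC₁.le hC₂.le
  have hrate : rateB C.κ₁ C.Eb C.μ (2 * cA) (cB + 2 * cA * dC) = survivalRate Δ₁ c₃ := rateB_withBanks hC₁ hC₂
  have hA0 : 0 ≤ C.A₀ := hA.le
  -- ONE infrared value past which the pay inequalities hold along every run of the typed flow
  obtain ⟨x₀, hx₀⟩ := exists_payThreshold C hV ha hA hL hβ hrq
  refine ⟨x₀, ?_⟩
  intro l₀ T A B Bad nup mup nlow mlow Cst K₀ jstar Nanc c hRA hRB hEA hEB hCst hj hNanc hc hfrac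
  -- the flow facts give the pay inequalities; so `RunReadingsFlowLE` gives `OccLeaves`
  have toLeaves : ∀ {X : ℕ → ℝ → ι → ℝ} {xup : ℕ → ℝ → ℝ} {K : ℕ} {t : ℝ},
      RunReadingsFlowLE C L r β₀ x₀ T X Bad xup jstar Δ₁ Nanc cA cB dC c₃ K t →
        OccLeaves T X Bad xup jstar Nanc Δ₁ (rateB C.κ₁ C.Eb C.μ (2 * cA) (cB + 2 * cA * dC) - c₃) K t := by
    intro X xup K t h
    obtain ⟨Cell, hF, hD, M, hR, Δ, Kc, R, g, β', hT, h27, h29, hRj, hx1, hxK, hL'⟩ := h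
    exact occLeaves_of_readingsLE hV hA0 hL hcA hcB hdC hT h29 hRj hx1 (hx₀ Kc R g β' h27 hRj hx1 hxK) hL'
  have key := exists_relWeightBound_of_occLeaves
    (fun K t ht hK => toLeaves (hRA K t ht hK)) (fun K t ht hK => toLeaves (hRB K t ht hK))
    hEA hEB hCst hj hNanc hΔ₁ (by rw [hrate]; exact survives_of_lt hΔ₁ (lt_survivalRate Δ₁ c₃)) hc hfrac
  rw [hrate] at key
  exact key

end Flow

end

end Summit.QuantumFields.BalabanUV.T4Continuum.SpaceTimePeierls
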